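import Summits.Ventures.YMGap.RobustBall.ZNGaugeLayer
import HarnessLib

/-!
# RobustBall/ZNSpinTwoPoint — two-point bound for shift-symmetric `ℤ_N`-valued finite spin systems from Dobrushin
# row sums: `‖E ψ(σ_b − σ_t)‖ ≤ 4 c^{ℓ(b)}` for any `1`-Lipschitz profile `ℓ` vanishing at `t`

HONEST FRAMING: venture file of the cell `pub-ymgap` (track Y2 ROBUST-BALL, seat ds-4 g8): finite sums, no measure theory.
It is the ABSTRACT form of gen 7's `ZN.norm_cavg_ψ_sub_le` / gen 8's `ZNFlux.norm_cavg_ψ_sub_le`: a positive weight `w` on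
`V → ℤ/N` which is invariant under the global shift `σ ↦ σ + 1` (so one-point functions `E ψ(σ_b)` vanish for `N ≥ 2`,
`cavg_ψ_eval_eq_zero_of_shift`), one-site total-variation influences `≤ C x y` supported on `nbr` with row sums `≤ c ≤ 1`,
and ANY profile `ℓ : V → ℕ` with `ℓ t = 0`, `ℓ x ≤ ℓ y + 1` for `y ∈ nbr x` (e.g. `⌈dist_j(t, ·)/r⌉` when neighbours are at
`j`-distance `≤ r`): `‖E ψ(σ_b − σ_t)‖ ≤ 4 · c^{ℓ b}` (`norm_cavg_ψ_sub_le_of_shift`; condition on `σ_t`, Dobrushin comparison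
`FiniteGibbs.abs_avg_sub_avg_fiber_le`, oscillation `2` for `Re ψ`, `Im ψ`).  Consumer: the windowed centre-tube area law
(`ZNFluxWindow*`).  Nothing about gauge theories or the continuum here.
-/

noncomputable section

open Finset Function
open Literature.MathematicalPhysics.QuantumFieldTheory

namespace Summit.Ventures.YMGap.RobustBall

namespace ZNSpin

variable {V : Type*} [Fintype V] [DecidableEq V] {N : ℕ} [NeZero N]

/-- **One-point functions vanish under shift symmetry** (`N ≥ 2`): if `w (σ + 1) = w σ` then `E ψ(σ_b) = 0`. [folklore] -/
theorem cavg_ψ_eval_eq_zero_of_shift (hN : 2 ≤ N) {w : (V → ZMod N) → ℝ}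
    (hshift : ∀ σ, w (σ + fun _ => 1) = w σ) (b : V) :
    FiniteGibbs.cavg w (fun σ => ψ N (σ b)) = 0 := by
  have hsum : ∑ σ : V → ZMod N, (w σ : ℂ) * ψ N (σ b) = ψ N 1 * ∑ σ : V → ZMod N, (w σ : ℂ) * ψ N (σ b) := by
    have hre : ∑ σ : V → ZMod N, (w σ : ℂ) * ψ N (σ b) =
        ∑ σ : V → ZMod N, (w (σ + fun _ => (1 : ZMod N)) : ℂ) * ψ N (σ b + 1) := by
      refine (Fintype.sum_equiv (Equiv.addRight (fun _ : V => (1 : ZMod N))) _ _ fun σ => ?_).symm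
      simp only [Equiv.coe_addRight, Pi.add_apply]
    conv_lhs => rw [hre]
    rw [Finset.mul_sum]
    refine Finset.sum_congr rfl fun σ _ => ?_
    rw [hshift, ψ_add]
    ring
  have hz : (1 - ψ N 1) * ∑ σ : V → ZMod N, (w σ : ℂ) * ψ N (σ b) = 0 := by
    rw [sub_mul, one_mul, ← hsum, sub_self]
  rcases mul_eq_zero.1 hz with h | h
  · exact absurd (sub_eq_zero.1 h).symm (ψ_one_ne_one hN)
  · rw [FiniteGibbs.cavg, h, zero_div]

/-- **Two-point bound for shift-symmetric `ℤ_N` spin systems** (`N ≥ 2`): positive shift-invariant weight, one-site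
influences `≤ C` supported on `nbr` with row sums `≤ c ≤ 1`, profile `ℓ` vanishing at `t` and `1`-Lipschitz along `nbr`
⇒ `‖E ψ(σ_b − σ_t)‖ ≤ 4 · c^{ℓ b}`. [folklore] -/
theorem norm_cavg_ψ_sub_le_of_shift (hN : 2 ≤ N) {w : (V → ZMod N) → ℝ} (hw : ∀ σ, 0 < w σ)
    (hshift : ∀ σ, w (σ + fun _ => 1) = w σ) {C : V → V → ℝ} {nbr : V → Finset V} (hC0 : ∀ x y, 0 ≤ C x y)
    (hCz : ∀ x y, y ∉ nbr x → C x y = 0)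
    (htv : ∀ x y, y ≠ x → ∀ σ τ : V → ZMod N, (∀ z, z ≠ y → σ z = τ z) → FiniteGibbs.tv w x σ τ ≤ C x y)
    {c : ℝ} (hc0 : 0 ≤ c) (hc1 : c ≤ 1) (hrow : ∀ x, ∑ y ∈ nbr x, C x y ≤ c) (t : V) (ℓ : V → ℕ) (hℓt : ℓ t = 0)
    (hℓ : ∀ x, x ≠ t → ∀ y ∈ nbr x, ℓ x ≤ ℓ y + 1) (b : V) :
    ‖FiniteGibbs.cavg w (fun σ => ψ N (σ b - σ t))‖ ≤ 4 * c ^ ℓ b := by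
  classical
  have hcomp : ∀ (φ : ZMod N → ℝ), (∀ s s', |φ s - φ s'| ≤ 2) → ∀ s₀ : ZMod N,
      |FiniteGibbs.avg w (fun σ => φ (σ b)) - FiniteGibbs.avg (FiniteGibbs.fiber w t s₀) (fun σ => φ (σ b))| ≤
        c ^ ℓ b * 2 := fun φ hφ s₀ =>
    FiniteGibbs.abs_avg_sub_avg_fiber_le hw hC0 hCz htv hc0 hc1 hrow t ℓ hℓt hℓ s₀ b φ hφ
  have hosc_re : ∀ s s' : ZMod N, |(ψ N s).re - (ψ N s').re| ≤ 2 := fun s s' => by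
    rw [← Complex.sub_re]
    refine (Complex.abs_re_le_norm _).trans ((norm_sub_le _ _).trans ?_)
    rw [norm_ψ, norm_ψ]; norm_num
  have hosc_im : ∀ s s' : ZMod N, |(ψ N s).im - (ψ N s').im| ≤ 2 := fun s s' => by
    rw [← Complex.sub_im]
    refine (Complex.abs_im_le_norm _).trans ((norm_sub_le _ _).trans ?_)
    rw [norm_ψ, norm_ψ]; norm_num
  have hB : ∀ s₀ : ZMod N, 0 < FiniteGibbs.mass (FiniteGibbs.fiber w t s₀) →
      ‖FiniteGibbs.cavg (FiniteGibbs.fiber w t s₀) (fun σ => ψ N (σ b)) -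
        FiniteGibbs.cavg w (fun σ => ψ N (σ b))‖ ≤ 4 * c ^ ℓ b := by
    intro s₀ _
    refine (FiniteGibbs.norm_cavg_sub_cavg_le _ _ _).trans ?_
    have h1 := hcomp (fun s => (ψ N s).re) hosc_re s₀
    have h2 := hcomp (fun s => (ψ N s).im) hosc_im s₀
    rw [abs_sub_comm] at h1 h2
    linarith
  have hmain := FiniteGibbs.norm_cavg_mul_sub_le (fun σ => (hw σ).le) (FiniteGibbs.mass_pos_of_pos hw) t
    (fun σ => ψ N (σ b)) (fun s => ψ N (-s)) (MG := 1) (fun s => (norm_ψ _).le) hB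
  rw [cavg_ψ_eval_eq_zero_of_shift hN hshift, zero_mul, sub_zero, one_mul] at hmain
  have heq : (fun σ : V → ZMod N => ψ N (σ b) * ψ N (-σ t)) = fun σ => ψ N (σ b - σ t) := by
    funext σ; rw [← ψ_add, sub_eq_add_neg]
  rw [heq] at hmain
  exact hmain

/-! ### The block-conditioning bound: an average is a convex combination of block-conditioned averages -/

/-- Merge: `σ` on `B`, `κ` off `B` (`Finset.piecewise`). [folklore] -/
theorem sum_sum_piecewise_eq {S : Type*} [Fintype S] (B : Finset V) (f : (V → S) → ℂ) :
    ∑ κ : V → S, ∑ σ : V → S, f (B.piecewise σ κ) = (Fintype.card (V → S) : ℂ) * ∑ τ : V → S, f τ := by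
  classical
  calc ∑ κ : V → S, ∑ σ : V → S, f (B.piecewise σ κ)
      = ∑ p : (V → S) × (V → S), f ((FiniteGibbs.blockSwap B p).2) :=
        (Fintype.sum_prod_type' (fun κ σ => f (B.piecewise σ κ))).symm
    _ = ∑ p : (V → S) × (V → S), f p.2 := Fintype.sum_equiv (FiniteGibbs.blockSwap B) _ _ fun _ => rfl
    _ = (Fintype.card (V → S) : ℂ) * ∑ τ : V → S, f τ := by
        rw [Fintype.sum_prod_type]
        simp only [Finset.sum_const, Finset.card_univ, nsmul_eq_mul]

/-- **Block conditioning bound**: for a nonnegative weight `ρ` of positive mass and the block-conditioned weights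
`ρ_κ σ := ρ (B.piecewise σ κ)` (spins on `B` free, spins off `B` frozen to `κ`; the off-`B` coordinates of `σ` are dummies),
if every `‖cavg ρ_κ (H ∘ B.piecewise · κ)‖ ≤ M` then `‖cavg ρ H‖ ≤ M`. [folklore] -/
theorem norm_cavg_le_of_piecewise {S : Type*} [Fintype S] [Nonempty S] (B : Finset V) {ρ : (V → S) → ℝ}
    (hρ : ∀ σ, 0 ≤ ρ σ) (hm : 0 < FiniteGibbs.mass ρ) (H : (V → S) → ℂ) {M : ℝ}
    (hM : ∀ κ : V → S, 0 < FiniteGibbs.mass (fun σ => ρ (B.piecewise σ κ)) →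
      ‖FiniteGibbs.cavg (fun σ => ρ (B.piecewise σ κ)) (fun σ => H (B.piecewise σ κ))‖ ≤ M) :
    ‖FiniteGibbs.cavg ρ H‖ ≤ M := by
  classical
  have hK : (0 : ℝ) < Fintype.card (V → S) := by exact_mod_cast Fintype.card_pos
  -- numerator and mass as sums over the frozen part
  have hnum : (Fintype.card (V → S) : ℂ) * ∑ τ : V → S, (ρ τ : ℂ) * H τ =
      ∑ κ : V → S, ∑ σ : V → S, (ρ (B.piecewise σ κ) : ℂ) * H (B.piecewise σ κ) :=
    (sum_sum_piecewise_eq B fun τ => (ρ τ : ℂ) * H τ).symm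
  have hmass : (Fintype.card (V → S) : ℝ) * FiniteGibbs.mass ρ =
      ∑ κ : V → S, FiniteGibbs.mass (fun σ => ρ (B.piecewise σ κ)) := by
    have h := sum_sum_piecewise_eq B fun τ => (ρ τ : ℂ)
    simp only [FiniteGibbs.mass]
    exact_mod_cast h.symm
  -- each fibre: ‖numerator_κ‖ ≤ M · mass_κ
  have hfib : ∀ κ : V → S, ‖∑ σ : V → S, (ρ (B.piecewise σ κ) : ℂ) * H (B.piecewise σ κ)‖ ≤
      M * FiniteGibbs.mass (fun σ => ρ (B.piecewise σ κ)) := by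
    intro κ
    have hm0 : 0 ≤ FiniteGibbs.mass (fun σ => ρ (B.piecewise σ κ)) := Finset.sum_nonneg fun σ _ => hρ _
    rcases hm0.eq_or_lt with h0 | hpos
    · have hz : ∀ σ, ρ (B.piecewise σ κ) = 0 := fun σ =>
        (Finset.sum_eq_zero_iff_of_nonneg fun σ _ => hρ (B.piecewise σ κ)).1 h0.symm σ (Finset.mem_univ σ)
      simp [hz, FiniteGibbs.mass]
    · have h := hM κ hpos
      rw [FiniteGibbs.cavg, norm_div, Complex.norm_real, Real.norm_eq_abs, abs_of_pos hpos, div_le_iff₀ hpos] at h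
      exact h
  rw [FiniteGibbs.cavg, norm_div, Complex.norm_real, Real.norm_eq_abs, abs_of_pos hm, div_le_iff₀ hm]
  have key : ‖(Fintype.card (V → S) : ℂ) * ∑ τ : V → S, (ρ τ : ℂ) * H τ‖ ≤
      (Fintype.card (V → S) : ℝ) * (M * FiniteGibbs.mass ρ) := by
    rw [hnum, mul_left_comm, hmass, Finset.mul_sum]
    exact (norm_sum_le _ _).trans (Finset.sum_le_sum fun κ _ => hfib κ)
  rw [norm_mul, Complex.norm_natCast] at key
  exact le_of_mul_le_mul_left key hK

end ZNSpin

end Summit.Ventures.YMGap.RobustBall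

end
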